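import Literature.AlgebraicGeometry.Resolution.AdmissibleBlowups
import Literature.AlgebraicGeometry.Resolution.StrictTransformLocality
import HarnessLib

/-!
# Raynaud–Gruson flattening by admissible blowing ups (Stacks 081R): reduction to an affine
# source

Topic: `Literature/AlgebraicGeometry/Resolution`. The named fact `Stacks081R`
(`StrictTransformFlattening.lean`; Raynaud–Gruson 1971, Première partie, Thm. 5.2.2, in the form
of the Stacks Project, Tag 081R = More on Flatness, Lemma 38.31.1) states: for `S` quasi-compact
and quasi-separated, `U ⊆ S` a quasi-compact open and `f : X → S` of finite type and
quasi-separated with `X_U → U` flat and locally of finite presentation, there is a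
`U`-admissible blowing up `S' → S` such that the strict transform of `X` is flat and locally of
finite presentation over `S'`. Its printed proof begins: "Since `X` is quasi-compact we can find
a finite affine open covering `X = ⋃ Xᵢ`. If we can find `U`-admissible blowups `bᵢ : Sᵢ → S`
such that the strict transform of `Xᵢ` is flat and of finite presentation over `Sᵢ`, then
there exists a `U`-admissible blowing up `b : S' → S` dominating the `bᵢ` (Divisors,
Lemma 31.35.4 = Tag 080N) and the strict transforms along `b` are flat and of finite presentation
[…]. Hence we may assume `X` is affine." This file PROVES that reduction:

* `stacks081R_of_affine` — **`Stacks081R` follows from its special case where the source `X` is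
  moreover affine** (the hypothesis is the literal statement of `Stacks081R` with `[IsAffine X]`
  added; it is an explicit hypothesis of the theorem, not a new named fact).

The ingredients, all proved: a finite affine open cover of the quasi-compact `X`
(`Literature.AlgebraicGeometry.Limits.exists_finset_affineOpens_iSup_eq_top`); the affine case
applied to the restrictions `Xᵢ → S` (quasi-compact, of finite type, quasi-separated, flat and
locally of finite presentation over `U`); a single `U`-admissible blowing up dominating the
finitely many `bᵢ` (Stacks 080N, `IsBlowup.exists_isBlowup_prod_dominating`,
`AdmissibleBlowups.lean`); persistence of flatness and local finite presentation of the strict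
transforms of the `Xᵢ` along the dominating blowing up
(`flat_blowupStrictTransformMap_of_dominating`,
`locallyOfFinitePresentation_blowupStrictTransformMap_of_dominating`,
`StrictTransformPersistence.lean`); and locality on the source of the strict transform and of
the two properties (`blowupStrictTransformMap_of_iSup_eq_top`, `StrictTransformLocality.lean`).

What remains of `Stacks081R` after this reduction is its affine case, i.e. (Stacks, proof of
081R, second paragraph) an immersion `X → 𝐀ⁿ_S` (Morphisms, Lemma 29.39.2 = Tag 04II) reducing
it to the module version, More on Flatness, Theorem 38.30.7 = Tag 0815 — the heart of
Raynaud–Gruson, Première partie, §5.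

## References

* The Stacks Project, Tag 081R (More on Flatness, Lemma 38.31.1) and its proof; Tag 080N;
  Tag 080D. [StacksProject]
* M. Raynaud, L. Gruson, *Critères de platitude et de projectivité. Techniques de
  «platification» d'un module*, Invent. Math. 13 (1971) 1–89, Première partie, Thm. 5.2.2.
  [RaynaudGruson1971]
-/

noncomputable section

open CategoryTheory CategoryTheory.Limits AlgebraicGeometry TopologicalSpace

namespace Literature.AlgebraicGeometry.Resolution

universe u

open Literature.AlgebraicGeometry.Limits

/-- A finite product of ideal sheaves is contained in each factor. [folklore] -/
theorem finsetProd_le {X : Scheme.{u}} {ι : Type*} [DecidableEq ι] (s : Finset ι)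
    (I : ι → X.IdealSheafData) {i : ι} (hi : i ∈ s) : ∏ j ∈ s, I j ≤ I i := by
  rw [← Finset.mul_prod_erase s I hi]
  calc I i * ∏ j ∈ s.erase i, I j ≤ I i * 1 :=
        mul_le_mul_of_nonneg_left le_top bot_le
    _ = I i := mul_one _

/-- **Raynaud–Gruson flattening (Stacks, Tag 081R) follows from its case of an affine source.**
If for every `f : X → S` with `X` AFFINE, `S` quasi-compact and quasi-separated, `f`
quasi-compact, locally of finite type and quasi-separated, and every quasi-compact open `U ⊆ S`
over which `f` is flat and locally of finite presentation, there is an ideal sheaf `𝓘` of finite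
type on `S` with support disjoint from `U` and a blowing up `b : S' → S` of `S` in `𝓘` such that
the strict transform of `X` along `b` is flat and locally of finite presentation over `S'` — the
statement of `Stacks081R` for affine `X` — then `Stacks081R` holds. Proof as printed (Stacks,
proof of 081R, first paragraph): cover `X` by finitely many affine opens `Xᵢ`; the affine case
gives `U`-admissible blowing ups `bᵢ : Sᵢ → S` flattening the strict transforms of the
`Xᵢ → S`; the blowing up `b : S' → S` in the product of their centres is `U`-admissible and
dominates them by `bᵢ⁻¹U`-admissible blowing ups `S' → Sᵢ` (Tag 080N); along `b` the strict
transform of each `Xᵢ` is the base change of the strict transform along `bᵢ`, hence flat and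
locally of finite presentation; these are the open pieces of the strict transform of `X` over the
`Xᵢ`, and flatness and local finite presentation are local on the source.
[cite: StacksProject, Tag 081R (proof)] -/
theorem stacks081R_of_affine
    (h : ∀ ⦃X S : Scheme.{u}⦄ (f : X ⟶ S) [IsAffine X] [CompactSpace S] [QuasiSeparatedSpace S]
      [QuasiCompact f] [LocallyOfFiniteType f] [QuasiSeparated f] (U : S.Opens),
      IsCompact (U : Set S) → Flat (f ∣_ U) → LocallyOfFinitePresentation (f ∣_ U) →
      ∃ (I : S.IdealSheafData) (S' : Scheme.{u}) (b : S' ⟶ S),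
        (∀ W : S.affineOpens, (I.ideal W).FG) ∧ Disjoint (U : Set S) (I.support : Set S) ∧
        IsBlowup b I ∧ Flat (blowupStrictTransformMap f b I) ∧
        LocallyOfFinitePresentation (blowupStrictTransformMap f b I)) :
    Stacks081R.{u} := by
  intro X S f _ _ _ _ _ U hU hflat hlfp
  classical
  haveI : CompactSpace X := QuasiCompact.compactSpace_of_compactSpace f
  obtain ⟨t, ht⟩ := exists_finset_affineOpens_iSup_eq_top X
  have ht' : ⨆ V : t, (((V : X.affineOpens) : X.Opens)) = ⊤ :=
    top_le_iff.mp (ht.trans (le_of_eq iSup_subtype'))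
  -- the affine case for the restrictions `Xᵢ → S`, `Xᵢ ∈ t`
  have hV : ∀ V : t, ∃ (I : S.IdealSheafData) (S' : Scheme.{u}) (b : S' ⟶ S),
      (∀ W : S.affineOpens, (I.ideal W).FG) ∧ Disjoint (U : Set S) (I.support : Set S) ∧
      IsBlowup b I ∧ Flat (blowupStrictTransformMap (((V : X.affineOpens) : X.Opens).ι ≫ f) b I) ∧
        LocallyOfFinitePresentation
          (blowupStrictTransformMap (((V : X.affineOpens) : X.Opens).ι ≫ f) b I) := by
    intro V
    haveI : IsAffine (((V : X.affineOpens) : X.Opens) : Scheme.{u}) := (V : X.affineOpens).2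
    haveI := hflat
    haveI := hlfp
    haveI : Flat ((((V : X.affineOpens) : X.Opens).ι ≫ f) ∣_ U) := by
      rw [morphismRestrict_comp]
      show Flat ((((V : X.affineOpens) : X.Opens).ι ∣_ (f ⁻¹ᵁ U)) ≫ f ∣_ U)
      infer_instance
    haveI : LocallyOfFinitePresentation ((((V : X.affineOpens) : X.Opens).ι ≫ f) ∣_ U) := by
      rw [morphismRestrict_comp]
      show LocallyOfFinitePresentation ((((V : X.affineOpens) : X.Opens).ι ∣_ (f ⁻¹ᵁ U)) ≫ f ∣_ U)
      infer_instance
    exact h _ U hU inferInstance inferInstance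
  choose I S₁ b₁ hIfg hIU hb₁ hflat₁ hlfp₁ using hV
  -- one `U`-admissible blowing up dominating the `b₁ V` (Stacks 080N)
  obtain ⟨S', c, hc, hcfg, hcU, hdom⟩ :=
    IsBlowup.exists_isBlowup_prod_dominating U b₁ I hb₁ hIfg hIU
  choose g hg _hgb _hgfg _hgU using hdom
  have hsupp : ∀ V : t, ((I V).support : Set S) ⊆ ((∏ W, I W).support : Set S) := fun V x hx =>
    Scheme.IdealSheafData.support_antitone (finsetProd_le Finset.univ I (Finset.mem_univ V)) hx
  have hE : IsEffectiveCartier ((∏ W, I W).comap c) := hc.isEffectiveCartier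
  haveI : ∀ V : t, Flat (blowupStrictTransformMap (((V : X.affineOpens) : X.Opens).ι ≫ f) c (∏ W, I W)) :=
    fun V => haveI := hflat₁ V
      flat_blowupStrictTransformMap_of_dominating (Iᵢ := I V) (I := ∏ W, I W) (hg V) (hsupp V) hE
  refine ⟨∏ V, I V, S', c, hcfg, hcU, hc, ?_, ?_⟩
  · exact blowupStrictTransformMap_of_iSup_eq_top f c (∏ V, I V) @Flat hE
      (fun V : t => ((V : X.affineOpens) : X.Opens)) ht' fun V => inferInstance
  · refine blowupStrictTransformMap_of_iSup_eq_top f c (∏ V, I V) @LocallyOfFinitePresentation hE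
      (fun V : t => ((V : X.affineOpens) : X.Opens)) ht' fun V => ?_
    haveI := hflat₁ V
    haveI := hlfp₁ V
    exact locallyOfFinitePresentation_blowupStrictTransformMap_of_dominating (Iᵢ := I V)
      (I := ∏ W, I W) (hg V) (hsupp V) hE

end Literature.AlgebraicGeometry.Resolution

end
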